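import Literature.NumberTheory.Weil1964.AdelicSchrodingerL2Irreducible
import Literature.NumberTheory.Automorphic.SchwartzBruhatL2Dense
import Literature.NumberTheory.Automorphic.GlobalAdditiveCharacter
import Mathlib.Topology.Algebra.Nonarchimedean.TotallyDisconnected
import HarnessLib

/-!
# The `L²` model of `ρ_ψ` on `L²(𝐀_K^ι)` COMPLETES the smooth model: `𝒮(𝐀_K^ι) ⊂ L²(𝐀_K^ι)` is dense and equivariant

Topic `NumberTheory/Weil1964`; namespace `Literature.NumberTheory.Weil1964`.  KERNEL ONLY: theorems; no definition, no
named fact, no record, no `sorry`.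

[Weil1964, Chap. I n° 11] works with the unitary Schrödinger operators on `L²(X)` and uses that the Schwartz–Bruhat space
`𝒮(X)` is a dense subspace stable under them; [GelbartRogawski1991, §3.1 p. 454 L19–21] quantify over the unitary
(Hilbert-space) `ρ_ψ`.  The tree's smooth model of record is `adelicSchrodinger K ι T` on `piSchwartzBruhat K ι = 𝒮(𝐀_K^ι)`
(`AdelicHeisenbergSchrodinger.lean`), its `L²` completion `SchrodingerHaar.rep (adelicForm K ι T) ψ … ν` on `L²(𝐀_K^ι, ν)`
(`SchrodingerL2Haar.lean`; irreducible: `AdelicSchrodingerL2Irreducible.lean`).  This file proves that the second IS the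
completion of the first:

* §1 `nonarchimedeanAddGroup_finiteAdele_pi`, `totallyDisconnectedSpace_finiteAdele_pi` — `(𝐀_K^∞)^ι` has a basis of
  open subgroups at `0` (the scaled boxes `a · ∏_v 𝒪_v^ι`), hence is totally disconnected;
* §2 `memLp_two_tensor`, **`memLp_two_of_mem_piSchwartzBruhat`** — Schwartz–Bruhat functions on `𝐀_K^ι` are square
  integrable for every Haar measure (along `𝐀_K^ι ≅ (K ⊗ ℝ)^ι × (𝐀_K^∞)^ι`, `exists_haar_eq_smul_map_prod`, they are
  tensors of a Schwartz function and a locally constant compactly supported function);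
* §3 **`rep_toLp_eq_toLp_adelicSchrodinger`** — EQUIVARIANCE: on `𝒮(𝐀_K^ι) ⊂ L²` the `L²` operators are Weil's
  operators, `ρ_{L²}(h) [Φ] = [ρ(h) Φ]` (same pointwise formula `ψ_K(t + ⟨u, T y⟩) Φ(u + x)`);
* §4 **`dense_piSchwartzBruhat`** — DENSITY: the classes of Schwartz–Bruhat functions are dense in `L²(𝐀_K^ι, ν)`
  (Mathlib's density of Schwartz functions in `L²((K ⊗ ℝ)^ι)`, the tree's `SchwartzBruhat.dense_range_toLp` on the
  totally disconnected `(𝐀_K^∞)^ι`, tensor totality `dense_span_tensor`, and the unitary `F ↦ F ∘ split`).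

With `AdelicSchrodingerL2Irreducible` this completes ROADMAP item (A1) of the Track-2 kernel proof of [GelbartRogawski1991,
Prop. 3.1.1]: the printed Hilbert-space `ρ_ψ` realised as the completion of the smooth model on which the tree's
compatible splitting (`GRConstruction.gru_shape`) lives.  Nothing of the cited sources is asserted.

## References
* [Weil1964] A. Weil, Acta Math. 111 (1964), Chap. I n° 4 p. 149, n° 11 (density and stability of `𝒮(X)` in `L²(X)`).
* [GelbartRogawski1991] S. Gelbart, J. Rogawski, Invent. Math. 105 (1991), §3.1 p. 454 L19–21.
* [ReedSimonI1980] M. Reed, B. Simon, *Methods of Modern Mathematical Physics I* (1980), §II.4 Thm II.10.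
-/

set_option autoImplicit false

noncomputable section

open MeasureTheory Filter Set NumberField IsDedekindDomain NumberField.InfinitePlace NumberField.mixedEmbedding
  InfiniteAdeleRing
open scoped ENNReal Topology FourierTransform Pointwise RestrictedProduct Matrix SchwartzMap Classical
open Literature.RepresentationTheory.HeisenbergGroup Literature.RepresentationTheory.HeisenbergGroup.RestrictedPair
  Literature.NumberTheory.Automorphic Literature.MeasureTheory.Integral

namespace Literature.NumberTheory.Weil1964

attribute [local instance] secondCountableTopology_adeleRing locallyCompactSpace_adeleRing'
  secondCountableTopology_finiteAdeleRing locallyCompactSpace_finiteAdeleRing'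

variable (K : Type) [Field K] [NumberField K] (ι : Type) [Fintype ι] [DecidableEq ι]

/-! ## §1 `(𝐀_K^∞)^ι` is non-archimedean, hence totally disconnected -/

/-- **`(𝐀_K^∞)^ι` has a basis of open subgroups at `0`**: the scaled integral boxes `a · ∏_v 𝒪_v^ι`, `a ∈ (𝐀_K^∞)ˣ`
(`exists_units_smul_finiteAdele_integers_pi_subset`; open because `(∏ 𝒪_v^ι, ∏ 𝔠_v^ι)` is a dual lattice pair for
Tate's character). [cite: Weil1964, Chap. I n° 11] -/
theorem nonarchimedeanAddGroup_finiteAdele_pi : NonarchimedeanAddGroup (ι → FiniteAdeleRing (𝓞 K) K) := by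
  classical
  haveI : Fact (∀ v : HeightOneSpectrum (𝓞 K), IsOpen (v.adicCompletionIntegers K : Set (v.adicCompletion K))) :=
    ⟨fun _ => Valued.isOpen_valuationSubring _⟩
  have hpair := isDualLatticePair_finiteAdele_integers_conductor_pi (isGlobalAddChar_adeleAddChar K) (n := ι)
  refine ⟨fun U hU => ?_⟩
  obtain ⟨a, ha⟩ := exists_units_smul_finiteAdele_integers_pi_subset (K := K) U hU
  exact ⟨⟨_, (hpair.smul a).isOpen_left⟩, ha⟩

/-- **`(𝐀_K^∞)^ι` is totally disconnected** (a Hausdorff group with a basis of open subgroups).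
[cite: Weil1964, Chap. I n° 11] -/
theorem totallyDisconnectedSpace_finiteAdele_pi : TotallyDisconnectedSpace (ι → FiniteAdeleRing (𝓞 K) K) := by
  haveI : NonarchimedeanAddGroup (ι → FiniteAdeleRing (𝓞 K) K) := nonarchimedeanAddGroup_finiteAdele_pi K ι
  haveI : T2Space (FiniteAdeleRing (𝓞 K) K) :=
    (inferInstance : T2Space (Πʳ v : HeightOneSpectrum (𝓞 K), [v.adicCompletion K, v.adicCompletionIntegers K]))
  haveI : TotallySeparatedSpace (ι → FiniteAdeleRing (𝓞 K) K) := NonarchimedeanAddGroup.instTotallySeparated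
  infer_instance

/-! ## §2 Schwartz–Bruhat functions on `𝐀_K^ι` are square integrable -/

omit [DecidableEq ι] in
/-- the factorizable function `Φ_∞ ⊗ Φ_f` read on `(K ⊗ ℝ)^ι × (𝐀_K^∞)^ι` through the splitting is the tensor
`(a, b) ↦ Φ_∞(a) Φ_f(b)`. [cite: ReedSimonI1980, §II.4 Theorem II.10] -/
theorem tensor_comp_piAdeleSplit (Φinf : 𝓢((ι → mixedSpace K), ℂ)) (Φfin : (ι → FiniteAdeleRing (𝓞 K) K) → ℂ) :
    ((fun v : ι → AdeleRing (𝓞 K) K => Φinf (piArch K ι v) * Φfin (piFinite K ι v)) ∘ (piAdeleSplit K ι)) =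
      fun z => Φinf z.1 * Φfin z.2 := by
  funext z
  rw [Function.comp_apply, piArch_piAdeleSplit, piFinite_piAdeleSplit]

section MemLp

variable [MeasurableSpace (AdeleRing (𝓞 K) K)] [BorelSpace (AdeleRing (𝓞 K) K)]

omit [DecidableEq ι] in
/-- **a factorizable Schwartz–Bruhat function `Φ_∞ ⊗ Φ_f` is in `L²(𝐀_K^ι, ν)`** for every Haar measure `ν`.
[cite: Weil1964, Chap. I n° 11] -/
theorem memLp_two_tensor (ν : Measure (ι → AdeleRing (𝓞 K) K)) [ν.IsAddHaarMeasure] (Φinf : 𝓢((ι → mixedSpace K), ℂ))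
    {Φfin : (ι → FiniteAdeleRing (𝓞 K) K) → ℂ} (hfin : Φfin ∈ SchwartzBruhat (ι → FiniteAdeleRing (𝓞 K) K)) :
    MemLp (fun v : ι → AdeleRing (𝓞 K) K => Φinf (piArch K ι v) * Φfin (piFinite K ι v)) 2 ν := by
  classical
  letI mf : MeasurableSpace (FiniteAdeleRing (𝓞 K) K) := borel _
  haveI : BorelSpace (FiniteAdeleRing (𝓞 K) K) := ⟨rfl⟩
  haveI : BorelSpace (ι → AdeleRing (𝓞 K) K) := Pi.borelSpace
  haveI : BorelSpace (ι → FiniteAdeleRing (𝓞 K) K) := Pi.borelSpace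
  haveI : BorelSpace (ι → mixedSpace K) := Pi.borelSpace
  haveI : BorelSpace ((ι → mixedSpace K) × (ι → FiniteAdeleRing (𝓞 K) K)) := Prod.borelSpace
  set μM : Measure (ι → mixedSpace K) := Measure.addHaarMeasure (Classical.arbitrary _) with hμM
  haveI : μM.IsAddHaarMeasure := by rw [hμM]; infer_instance
  set μf : Measure (ι → FiniteAdeleRing (𝓞 K) K) := Measure.addHaarMeasure (Classical.arbitrary _) with hμf
  haveI : μf.IsAddHaarMeasure := by rw [hμf]; infer_instance
  obtain ⟨c, hc, hν⟩ := exists_haar_eq_smul_map_prod K ι ν μM μf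
  have hcont : Continuous fun v : ι → AdeleRing (𝓞 K) K => Φinf (piArch K ι v) * Φfin (piFinite K ι v) :=
    (Φinf.continuous.comp continuous_piArch).mul
      ((SchwartzBruhat.continuous_coe ⟨Φfin, hfin⟩).comp continuous_piFinite)
  have hmeas : AEMeasurable (piAdeleSplit K ι : _ → ι → AdeleRing (𝓞 K) K) (μM.prod μf) :=
    (piAdeleSplit K ι).continuous.measurable.aemeasurable
  have h1 : MemLp ((fun v : ι → AdeleRing (𝓞 K) K => Φinf (piArch K ι v) * Φfin (piFinite K ι v)) ∘
      (piAdeleSplit K ι)) 2 (μM.prod μf) := by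
    rw [tensor_comp_piAdeleSplit]
    exact memLp_tensor μM μf (Φinf.memLp 2 μM) (SchwartzBruhat.memLp μf ⟨Φfin, hfin⟩ 2)
  have h0 : MemLp (fun v : ι → AdeleRing (𝓞 K) K => Φinf (piArch K ι v) * Φfin (piFinite K ι v)) 2
      ((μM.prod μf).map (piAdeleSplit K ι)) :=
    (memLp_map_measure_iff hcont.aestronglyMeasurable hmeas).2 h1
  rw [hν, ← Measure.coe_nnreal_smul]
  exact h0.smul_measure ENNReal.coe_ne_top

omit [DecidableEq ι] in
/-- **every Schwartz–Bruhat function on `𝐀_K^ι` is in `L²(𝐀_K^ι, ν)`** (`ν` any Haar measure).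
[cite: Weil1964, Chap. I n° 11] -/
theorem memLp_two_of_mem_piSchwartzBruhat (ν : Measure (ι → AdeleRing (𝓞 K) K)) [ν.IsAddHaarMeasure]
    {Φ : (ι → AdeleRing (𝓞 K) K) → ℂ} (hΦ : Φ ∈ piSchwartzBruhat K ι) : MemLp Φ 2 ν := by
  induction hΦ using Submodule.span_induction with
  | mem Φ h =>
      obtain ⟨Φinf, Φfin, hfin, rfl⟩ := h
      exact memLp_two_tensor K ι ν Φinf hfin
  | zero => exact MemLp.zero'
  | add Φ Ψ _ _ hΦ hΨ => exact hΦ.add hΨ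
  | smul a Φ _ hΦ => exact hΦ.const_smul a

end MemLp

/-! ## §3 Equivariance: the `L²` operators extend Weil's operators on `𝒮(𝐀_K^ι)` -/

section Junction

variable [MeasurableSpace (AdeleRing (𝓞 K) K)] [BorelSpace (AdeleRing (𝓞 K) K)]

/-- **`ρ_{L²}(h) [Φ] = [ρ(h) Φ]` for `Φ ∈ 𝒮(𝐀_K^ι)`**: the `L²` Schrödinger operator of `h ∈ H(W_𝐀)` applied to the class of
a Schwartz–Bruhat function is the class of Weil's operator `adelicSchrodinger K ι T h` applied to it (both are
`u ↦ ψ_K(t + ⟨u, T y⟩) Φ(u + x)`). [cite: Weil1964, Chap. I n° 11] -/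
theorem rep_toLp_eq_toLp_adelicSchrodinger (T : Matrix ι ι (AdeleRing (𝓞 K) K))
    (ν : Measure (ι → AdeleRing (𝓞 K) K)) [ν.IsAddHaarMeasure] (h : AdelicHeisenberg K ι T)
    {Φ : (ι → AdeleRing (𝓞 K) K) → ℂ} (hΦ : Φ ∈ piSchwartzBruhat K ι) :
    SchrodingerHaar.rep (adelicForm K ι T) (adeleAddChar K) (isGlobalAddChar_adeleAddChar K).continuous
        (continuous_adelicForm_left K ι T) ν h ((memLp_two_of_mem_piSchwartzBruhat K ι ν hΦ).toLp Φ) =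
      (memLp_two_of_mem_piSchwartzBruhat K ι ν (adelicSchrodinger K ι T h ⟨Φ, hΦ⟩).2).toLp
        ((adelicSchrodinger K ι T h ⟨Φ, hΦ⟩ : piSchwartzBruhat K ι) : (ι → AdeleRing (𝓞 K) K) → ℂ) := by
  haveI : BorelSpace (ι → AdeleRing (𝓞 K) K) := Pi.borelSpace
  rw [SchrodingerHaar.rep_toLp]
  refine MemLp.toLp_congr _ _ (Eventually.of_forall fun u => ?_)
  rw [adelicSchrodinger_apply]
  exact congrArg₂ (· * ·) (congrArg (fun r : AdeleRing (𝓞 K) K => ((adeleAddChar K (h.t + r) : Circle) : ℂ))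
    (adelicForm_apply T u h.v.2)) rfl

end Junction

/-! ## §4 Density of `𝒮(𝐀_K^ι)` in `L²(𝐀_K^ι, ν)` -/

section Dense

variable [MeasurableSpace (AdeleRing (𝓞 K) K)] [BorelSpace (AdeleRing (𝓞 K) K)]

/-- **`𝒮(𝐀_K^ι)` is dense in `L²(𝐀_K^ι, ν)`** for every Haar measure `ν`: the classes of Schwartz–Bruhat functions
`{[Φ] ; Φ ∈ piSchwartzBruhat K ι}` form a dense subset of `Lp ℂ 2 ν`. [cite: Weil1964, Chap. I n° 11] -/
theorem dense_piSchwartzBruhat (ν : Measure (ι → AdeleRing (𝓞 K) K)) [ν.IsAddHaarMeasure] :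
    Dense {F : Lp ℂ 2 ν | ∃ Φ ∈ piSchwartzBruhat K ι, (F : (ι → AdeleRing (𝓞 K) K) → ℂ) =ᵐ[ν] Φ} := by
  classical
  letI mf : MeasurableSpace (FiniteAdeleRing (𝓞 K) K) := borel _
  haveI : BorelSpace (FiniteAdeleRing (𝓞 K) K) := ⟨rfl⟩
  haveI : BorelSpace (ι → AdeleRing (𝓞 K) K) := Pi.borelSpace
  haveI : BorelSpace (ι → FiniteAdeleRing (𝓞 K) K) := Pi.borelSpace
  haveI : BorelSpace (ι → mixedSpace K) := Pi.borelSpace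
  haveI : BorelSpace ((ι → mixedSpace K) × (ι → FiniteAdeleRing (𝓞 K) K)) := Prod.borelSpace
  haveI := totallyDisconnectedSpace_finiteAdele_pi K ι
  set μM : Measure (ι → mixedSpace K) := Measure.addHaarMeasure (Classical.arbitrary _) with hμM
  haveI : μM.IsAddHaarMeasure := by rw [hμM]; infer_instance
  set μf : Measure (ι → FiniteAdeleRing (𝓞 K) K) := Measure.addHaarMeasure (Classical.arbitrary _) with hμf
  haveI : μf.IsAddHaarMeasure := by rw [hμf]; infer_instance
  obtain ⟨c, hc, hν⟩ := exists_haar_eq_smul_map_prod K ι ν μM μf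
  set S := piAdeleSplit K ι with hS
  set ν₀ : Measure (ι → AdeleRing (𝓞 K) K) := (μM.prod μf).map S with hν₀
  haveI : (μM.prod μf).IsAddHaarMeasure := Measure.prod.instIsAddHaarMeasure μM μf
  haveI : ν₀.IsAddHaarMeasure := by rw [hν₀]; exact S.isAddHaarMeasure_map (μM.prod μf)
  have hSm : MeasurePreserving S (μM.prod μf) ν₀ := ⟨S.continuous.measurable, rfl⟩
  have hSm' : MeasurePreserving S.symm ν₀ (μM.prod μf) := by
    have h := hSm.symm S.toHomeomorph.toMeasurableEquiv
    exact h
  /- the Schwartz–Bruhat classes as a submodule of `L²(ν₀)` -/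
  let D : ∀ (ρ : Measure (ι → AdeleRing (𝓞 K) K)), Submodule ℂ (Lp ℂ 2 ρ) := fun ρ =>
    { carrier := {F : Lp ℂ 2 ρ | ∃ Φ ∈ piSchwartzBruhat K ι, (F : (ι → AdeleRing (𝓞 K) K) → ℂ) =ᵐ[ρ] Φ}
      add_mem' := by
        rintro F G ⟨Φ, hΦ, hF⟩ ⟨Ψ, hΨ, hG⟩
        exact ⟨Φ + Ψ, (piSchwartzBruhat K ι).add_mem hΦ hΨ, (Lp.coeFn_add F G).trans (hF.add hG)⟩
      zero_mem' := ⟨0, (piSchwartzBruhat K ι).zero_mem, Lp.coeFn_zero ℂ 2 ρ⟩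
      smul_mem' := by
        rintro a F ⟨Φ, hΦ, hF⟩
        refine ⟨a • Φ, (piSchwartzBruhat K ι).smul_mem a hΦ, (Lp.coeFn_smul a F).trans ?_⟩
        filter_upwards [hF] with u hu
        rw [Pi.smul_apply, Pi.smul_apply, hu] }
  have hD : ∀ (ρ : Measure (ι → AdeleRing (𝓞 K) K)) (F : Lp ℂ 2 ρ),
      F ∈ D ρ ↔ ∃ Φ ∈ piSchwartzBruhat K ι, (F : (ι → AdeleRing (𝓞 K) K) → ℂ) =ᵐ[ρ] Φ := fun ρ F => Iff.rfl
  /- Step 1: density in `L²(μM ⊗ μf)` of the tensors `Φ_∞ ⊗ Φ_f` -/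
  let a : 𝓢((ι → mixedSpace K), ℂ) → Lp ℂ 2 μM := fun f => f.toLp 2 μM
  let b : SchwartzBruhat (ι → FiniteAdeleRing (𝓞 K) K) → Lp ℂ 2 μf := fun g => SchwartzBruhat.toLp μf g
  have ha : Dense (Submodule.span ℂ (Set.range a) : Set (Lp ℂ 2 μM)) := by
    have h : DenseRange a := by
      have h' := SchwartzMap.denseRange_toLpCLM (E := ι → mixedSpace K) (F := ℂ) (p := 2) (μ := μM)
        ENNReal.ofNat_ne_top
      have e : (⇑(SchwartzMap.toLpCLM ℝ ℂ 2 μM) : 𝓢((ι → mixedSpace K), ℂ) → Lp ℂ 2 μM) = a :=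
        funext fun f => SchwartzMap.toLpCLM_apply
      rwa [e] at h'
    exact h.mono Submodule.subset_span
  have hb : Dense (Submodule.span ℂ (Set.range b) : Set (Lp ℂ 2 μf)) :=
    (SchwartzBruhat.dense_range_toLp μf).mono Submodule.subset_span
  have hD₀ := dense_span_tensor μM μf a b ha hb
  /- Step 2: transport to `L²(ν₀)` along the unitary `U⁻¹ : G ↦ G ∘ S⁻¹` -/
  obtain ⟨U, hU, hU'⟩ := SchrodingerHaar.exists_linearIsometryEquiv_compMeasurePreserving
    (S := (S : _ → ι → AdeleRing (𝓞 K) K)) (S' := (S.symm : (ι → AdeleRing (𝓞 K) K) → _)) hSm hSm'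
    (fun z => S.symm_apply_apply z) (fun v => S.apply_symm_apply v)
  have hmem : ∀ p : 𝓢((ι → mixedSpace K), ℂ) × SchwartzBruhat (ι → FiniteAdeleRing (𝓞 K) K),
      U.symm ((memLp_tensor_Lp μM μf (a p.1) (b p.2)).toLp _) ∈ D ν₀ := by
    rintro ⟨Φinf, Φfin⟩
    refine (hD ν₀ _).2 ⟨fun v => Φinf (piArch K ι v) * (Φfin : (ι → FiniteAdeleRing (𝓞 K) K) → ℂ) (piFinite K ι v),
      tensor_mem_piSchwartzBruhat Φinf Φfin.2, ?_⟩
    rw [hU']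
    have h1 := hSm'.quasiMeasurePreserving.ae_eq_comp
      ((MemLp.coeFn_toLp (memLp_tensor_Lp μM μf (a Φinf) (b Φfin))).trans
        (tensor_congr_ae μM μf (Φinf.coeFn_toLp 2 μM) (SchwartzBruhat.coeFn_toLp μf Φfin)))
    filter_upwards [Lp.coeFn_compMeasurePreserving ((memLp_tensor_Lp μM μf (a Φinf) (b Φfin)).toLp _) hSm', h1]
      with v e1 e2
    rw [e1, e2, Function.comp_apply, piAdeleSplit_symm_apply]
  have hD₁ : Dense (D ν₀ : Set (Lp ℂ 2 ν₀)) := by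
    have himg := (U.symm.surjective.denseRange).dense_image U.symm.continuous hD₀
    refine himg.mono ?_
    rintro _ ⟨G, hG, rfl⟩
    have hle : Submodule.span ℂ (Set.range fun p : 𝓢((ι → mixedSpace K), ℂ) ×
        SchwartzBruhat (ι → FiniteAdeleRing (𝓞 K) K) => (memLp_tensor_Lp μM μf (a p.1) (b p.2)).toLp _) ≤
        (D ν₀).comap (U.symm.toLinearEquiv : Lp ℂ 2 (μM.prod μf) →ₗ[ℂ] Lp ℂ 2 ν₀) := by
      refine Submodule.span_le.2 ?_
      rintro _ ⟨p, rfl⟩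
      exact hmem p
    exact hle hG
  /- Step 3: the scalar `c` -/
  have hν' : ν = (c : ℝ≥0∞) • ν₀ := by rw [hν, Measure.coe_nnreal_smul]
  subst hν'
  have hc0 : (c : ℝ≥0∞) ≠ 0 := ENNReal.coe_ne_zero.2 hc.ne'
  obtain ⟨V, hV, -⟩ := SchrodingerHaar.exists_continuousLinearEquiv_smul_measure ν₀ hc0 ENNReal.coe_ne_top
  have hae : ae ((c : ℝ≥0∞) • ν₀) = ae ν₀ := Measure.ae_ennreal_smul_measure_eq hc0 ν₀
  have himg := (V.symm.surjective.denseRange).dense_image V.symm.continuous hD₁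
  refine himg.mono ?_
  rintro _ ⟨G, ⟨Φ, hΦ, hG⟩, rfl⟩
  refine ⟨Φ, hΦ, ?_⟩
  have h := hV (V.symm G)
  rw [ContinuousLinearEquiv.apply_symm_apply] at h
  have h' : ((V.symm G : Lp ℂ 2 ((c : ℝ≥0∞) • ν₀)) : (ι → AdeleRing (𝓞 K) K) → ℂ) =ᵐ[ν₀] Φ := h.symm.trans hG
  rw [hae]
  exact h'

end Dense

end Literature.NumberTheory.Weil1964

end
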